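import Literature.Claims.NS.Bledsoe2026

/-!
# C86 `Bledsoe2026` — kernel countermodel at the exponent count of §4.4 p.7 (`Step_44_naiveHoelder`)

B. Bledsoe, *Global Regularity for 3D Navier–Stokes via Coherence Decay* (Zenodo 17116634, 2025).
§4.4 p.7 l.2–10: «By Calderón–Zygmund, ‖∇u‖_{L³} ≤ κ₃‖ω‖_{L³} (2) … Naively this yields the critical
bound ∫(ω·∇u)·ω|ω| ≲ κ₃‖ω‖³_{L³}, which does not close. The gain is the discount …
∫(ω·∇u)·ω|ω| ≤ κ₃‖ω‖³_{L³} − c(K)[ω] (3)» (= (B.4) p.20; inside the printed proof of (B.4), B.7 p.21,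
the same count recurs: «R_ℓ is dominated by κ₃‖ω‖³_{L³}»), with κ₃ = 5 (B.8(ii) p.21).

The left side of the «naive bound» has amplitude degree 4 (`|∇u|·|ω|³`), the right side degree 3: Hölder
with `‖∇u‖_{L³} ≤ κ₃‖ω‖_{L³}` gives `κ₃‖ω‖_{L³}‖ω‖³_{L^{9/2}}`, never `κ₃‖ω‖³_{L³}`. At the abstract
grain typed by the skeleton (`f = |∇u|`, `g = |ω|` decoupled), the profile `f = g = a·𝟙_B` (`B` the closed
unit ball) satisfies `‖f‖₃ ≤ 5‖g‖₃` and has `∫ f g³ = a⁴|B|`, `∫ g³ = a³|B|`: the bound with constant `C`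
fails as soon as `a > C` (`not_naiveHoelderConst`, every constant `C` — the print's «≲», the typed
step being the instance `C = 5`; `not_Step_44_naiveHoelder`,
the typed `κ₃ = 5`, is the instance `a = 6` of ns-claims-typist-8 g2's kit `killkit-Bledsoe2026.lean`
sha16 01f3e26c500d19f1, whose helpers are adopted here verbatim, re-homed to this namespace).
The concrete twin `Step_44_cubicStretchingBound` ((3)/(B.4) in the form `cubic_of_discount` reduces them to)
dies by the same count — amplitude scaling `u ↦ λu` at one test field with non-zero weighted stretching;
`not_discount_of_not_cubic` records the contrapositive of the skeleton's `cubic_of_discount` for that file.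

Class (cell vocabulary): false lemma (countermodel) at `Literature.Claims.NS.Bledsoe2026.Step_44_naiveHoelder`.
WHAT THIS IS NOT: not a claim about NS regularity or blow-up; not a claim about any author beyond the
typed locator.
-/

set_option linter.dupNamespace false

noncomputable section

open Set MeasureTheory

namespace Summit.NavierStokesRegularity.NavierStokesRegularity.Theorems.Bledsoe2026

open Literature.Claims.NS.Bledsoe2026

/-- The closed unit ball of `ℝ³`. -/
def B : Set E3 := Metric.closedBall 0 1

/-- `B` is measurable. [folklore] -/
theorem measurableSet_B : MeasurableSet B := Metric.isClosed_closedBall.measurableSet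

/-- `|B| < ∞`. [folklore] -/
theorem volume_B_lt_top : volume B < ⊤ := (ProperSpace.isCompact_closedBall (0 : E3) 1).measure_lt_top

/-- `|B| > 0`. [folklore] -/
theorem volume_B_pos : 0 < volume B := Metric.measure_closedBall_pos volume (0 : E3) one_pos

/-- `|B| > 0` as a real number. [folklore] -/
theorem volume_B_real_pos : 0 < volume.real B := by
  rw [measureReal_def]
  exact ENNReal.toReal_pos volume_B_pos.ne' volume_B_lt_top.ne

/-- Constants are integrable on `B`. [folklore] -/
theorem integrable_indicator_B_const (c : ℝ) : Integrable (B.indicator fun _ : E3 => c) := by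
  have h : IntegrableOn (fun _ : E3 => c) B volume := integrableOn_const (hs := volume_B_lt_top.ne)
  exact h.integrable_indicator measurableSet_B

/-- The toy profile `a·𝟙_B` (plays both `|∇u|` and `|ω|`). -/
def blob (a : ℝ) : E3 → ℝ := B.indicator fun _ => a

/-- `a·𝟙_B ≥ 0` for `a ≥ 0`. [folklore] -/
theorem blob_nonneg {a : ℝ} (ha : 0 ≤ a) (x : E3) : 0 ≤ blob a x := by
  unfold blob; by_cases hx : x ∈ B <;> simp [hx, ha]

/-- `(a·𝟙_B)³ = a³·𝟙_B`. [folklore] -/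
theorem blob_pow_three (a : ℝ) (x : E3) : blob a x ^ 3 = B.indicator (fun _ => a ^ 3) x := by
  unfold blob; by_cases hx : x ∈ B <;> simp [hx]

/-- `(a·𝟙_B)·(a·𝟙_B)³ = a⁴·𝟙_B`. [folklore] -/
theorem blob_mul_blob_pow_three (a : ℝ) (x : E3) :
    blob a x * blob a x ^ 3 = B.indicator (fun _ => a ^ 4) x := by
  unfold blob; by_cases hx : x ∈ B <;> simp [hx]; ring

/-- `∫ (a·𝟙_B)³ = a³|B|`. [folklore] -/
theorem integral_blob_pow_three (a : ℝ) : ∫ x, blob a x ^ 3 = volume.real B * a ^ 3 := by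
  simp_rw [blob_pow_three]
  rw [integral_indicator_const _ measurableSet_B, smul_eq_mul]

/-- `∫ (a·𝟙_B)(a·𝟙_B)³ = a⁴|B|`. [folklore] -/
theorem integral_blob_mul_blob_pow_three (a : ℝ) :
    ∫ x, blob a x * blob a x ^ 3 = volume.real B * a ^ 4 := by
  simp_rw [blob_mul_blob_pow_three]
  rw [integral_indicator_const _ measurableSet_B, smul_eq_mul]

/-- **Kill, every constant**: `f = g = a·𝟙_B` with `a = max C 0 + 1` has `‖f‖₃ ≤ 5‖g‖₃`,
`∫ f g³ = a⁴|B| > C a³|B| = C ∫ g³` (amplitude degree 4 against 3).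
[cite: Bledsoe2026, §4.4 (2)–(3) p.7 l.2–10; (B.4) p.20; B.7 p.21] -/
theorem not_naiveHoelderConst (C : ℝ) :
    ¬ (∀ f g : E3 → ℝ, (∀ x, 0 ≤ f x) → (∀ x, 0 ≤ g x) →
      Integrable (fun x => f x ^ 3) → Integrable (fun x => g x ^ 3) →
      Integrable (fun x => f x * g x ^ 3) →
      (∫ x, f x ^ 3) ^ (1 / 3 : ℝ) ≤ 5 * (∫ x, g x ^ 3) ^ (1 / 3 : ℝ) →
      ∫ x, f x * g x ^ 3 ≤ C * ∫ x, g x ^ 3) := by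
  intro h
  set a : ℝ := max C 0 + 1 with ha
  have ha0 : 0 < a := by have := le_max_right C 0; linarith
  have haC : C < a := by have := le_max_left C 0; linarith
  have hf3 : Integrable (fun x => blob a x ^ 3) := by
    simp_rw [blob_pow_three]; exact integrable_indicator_B_const _
  have hfg : Integrable (fun x => blob a x * blob a x ^ 3) := by
    simp_rw [blob_mul_blob_pow_three]; exact integrable_indicator_B_const _
  have hyp : (∫ x, blob a x ^ 3) ^ (1 / 3 : ℝ) ≤ 5 * (∫ x, blob a x ^ 3) ^ (1 / 3 : ℝ) := by
    have h0 : 0 ≤ (∫ x, blob a x ^ 3) ^ (1 / 3 : ℝ) :=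
      Real.rpow_nonneg (by rw [integral_blob_pow_three]; positivity) _
    linarith
  have key := h (blob a) (blob a) (blob_nonneg ha0.le) (blob_nonneg ha0.le) hf3 hf3 hfg hyp
  rw [integral_blob_mul_blob_pow_three, integral_blob_pow_three] at key
  have hpos : 0 < volume.real B * a ^ 3 := mul_pos volume_B_real_pos (pow_pos ha0 3)
  have e : volume.real B * a ^ 4 = volume.real B * a ^ 3 * a := by ring
  rw [e] at key
  nlinarith [mul_pos hpos (sub_pos.2 haC)]

/-- **Kill** (typed grain, `κ₃ = 5`): the «naively this yields» exponent count of §4.4 p.7 is false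
(instance `C = 5` of `not_naiveHoelderConst`; typist-8 g2's kit toy `f = g = 6·𝟙_B`).
[cite: Bledsoe2026, §4.4 (2) p.7 l.2–5] -/
theorem not_Step_44_naiveHoelder : ¬ Step_44_naiveHoelder := not_naiveHoelderConst 5

/-- The concrete twin feeds the discount: by the skeleton's `cubic_of_discount`, a countermodel to
`Step_44_cubicStretchingBound` refutes the discount inequality (3)/(B.4) for EVERY non-negative functional
`Coh` and every `c_K ≥ 0` (recorded for the companion file; contrapositive only). -/
theorem not_discount_of_not_cubic (h : ¬ Step_44_cubicStretchingBound) (Coh : (E3 → E3) → ℝ) (cK : ℝ)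
    (hc : 0 ≤ cK) (hCoh : ∀ w, 0 ≤ Coh w) : ¬ Step_44_discount Coh cK :=
  fun hd => h (cubic_of_discount hc hCoh hd)

end Summit.NavierStokesRegularity.NavierStokesRegularity.Theorems.Bledsoe2026

end
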